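import Summits.QuantumFields.YangMills.Theorems.BalabanUVNodesN22W1RelCentredSliceInputsL2UAtPackage
import Literature.MathematicalPhysics.QuantumFieldTheory.Balaban1983to89.Node00.HistoryTermDatum214Free

/-!
# BalabanUVNodes ∕ node N22 = NE9 — THE RELATIVE-DISC CENTRED ROAD OVER THE ADMISSIBLE CLASS, MODULE J26-W: A6 FOR MODULE J26 — `nonempty_of_blocks_atPackage` FIRES AT
# DEGENERATE OBJECTS (its eighty-odd hypotheses are JOINTLY satisfiable, numerics included): the free (2.14) datum of node00-def-W1 W1-15, NODE A's free kernel record WITH A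
# DECAYING walk package, the zero complex reading of W1-17c, the zero localized action of W1-17d, empty boxes, the empty thickening

Cell `pub-ymgap`, HUMAN RULING D-0062 (Track A), R134 ACCELERATION re-seat `pub-ymgap-dag-n22-c` (strategy s1), generation 11, file J26-W.  THEOREMS ONLY; imports J26
`…SliceInputsL2UAtPackage` (`SliceInputsL2U.nonempty_of_blocks_atPackage`, p591296; through it J23, J25, J16, J20, J22, dag-n22-w1's box files) and node00-def-W1's W1-15
`Node00/HistoryTermDatum214Free` (the free datum's faces; NODE A's `B13TermWalkDataOneTorus.freeKernels`) BY NAME.  `--supports` K3⁷ `SpineGivenEndpointR13SepCoPH` (stmt-QuantumFields-20544)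
as a helper.

WHY (standing rule director-ym №189 ∕ №193: a hypothesis-heavy declaration owes an in-tree inhabitant of its hypotheses).  Module J26 `nonempty_of_blocks_atPackage` carries some eighty
hypotheses in producer currency (NODE A's walk record + package + numerics, σ-holomorphy, print's boxes + window clauses, one analytic action with laws, one complex reading with laws,
mixed numerals, closures, profile, τ-letters).  Each producer block has its own in-tree inhabitant (J16 ∕ `termWalkData_free`; J20 §3; dag-n22-w1's `printedBoxes_inhabited` and window
witnesses; J22 §4), but the blocks SHARE letters (the thickening `W`, the radius `RA`, the supports `S`, the rates, the package) and J26 PINS the kernel letters to the package — so the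
JOINT satisfiability of J26's hypothesis set, numerics included, is a fresh question (e.g. the free package `freeConsts` has no decay, `ε = 0`, hence `θ_E = 2K̄_E(1 + α∕R) ≥ 2` and J26's
kernel smallness `K̄_C·m·θ·m < 1` would FAIL on it).  THIS FILE answers it constructively: J26 APPLIED — every hypothesis discharged — at the free datum (one row bond, `ν = 0`, `m = 1`,
`A ≡ 1`, `G ≡ 0`, `C = 1`, `X = ∅`, `r = 1`), NODE A's free kernels WITH THE DECAYING PACKAGE `(R, ε, κ, K̄_Γ, K̄_E, K̄_C, R_σ) = (1, 1, 1, 0, 1, 1, 100)` (§1: the free kernels carry a walk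
record for EVERY package with `K̄_Γ ≥ 0`, `K̄_E, K̄_C ≥ 1` — the identity's one-term walk expansion decays at any rate), configurations of size `α = 1∕100`, rates `(κa, κb, κ′, κ″) =
(½, ¼, ⅛, 1⁄16)`, `θ = 1⁄10`, `ρ_b = 1⁄100` (so `θ_E = 2e^{−100} + 1⁄50`, `θ_Γ = θ_C·0 = …`, Schur constants `cE = 1`, `g = 0`), the EMPTY thickening `W = ∅` (every
configuration-analytic clause vacuous — said plainly: the NUMERIC and STRUCTURAL clauses are the content of this check, the analytic ones are each block's own A6), the zero complex
reading (`C = 0`, masses `0`, `M𝒪 = 0`), the zero action (`M𝒜 = M𝒲 = 0`, `RA = 2`, `𝔅c = univ`), print's boxes on EMPTY bond sets (`χᵘ = χᶜᵘ ≡ 1`, small-field label `t = (𝐃, ∅)`),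
threshold `ε₁ = 1`, weight `a = 0`, volume rate `a₅ = 1` on `|Z| ≥ 1`, window letters `T = e^{−(1∕s₀)²∕200}∕s₀²`, `Mv = 1 + T`, and W1-8's τ-letters `0 < τ(d) ≤ ½`, `κ₁ ≥ 1` as
hypotheses on the constants (as in J13 ∕ J17-W ∕ J21).

WHAT.  §1 `termWalkData_freeKernels` (NODE A's free kernel record carries `TermWalkData` for ANY package with `0 ≤ K̄_Γ`, `1 ≤ K̄_E`, `1 ≤ K̄_C` — any `R, ε, κ, R_σ` — generalises
`B13TermWalkDataOneTorus.termWalkData_free`, whose package is `freeConsts`).  §2 ★ `nonempty_of_blocks_atPackage_fires_free` — `∃ 𝔇 χu χcu Wc Oc Mv, Nonempty (SliceInputsL2U 𝔇 χu χcu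
(realSliceWilson Wc) (realSliceOlder Oc) c Sg Rz cs E₀ κ_E Z (𝐃, ∅) ∅ s₀ 0 1 (1∕100) Mv)` PROVED BY ONE APPLICATION OF J26 (the route is the content; the record type itself was already
inhabited by J12-W ∕ J13 ∕ J17-W along other roads).

HONEST FRAMING — what this is NOT.  An A6 ∕ non-vacuity certificate at DEGENERATE data; INHABITATION IS NOT CONTENT — nothing of Bałaban's kernels, actions, readings or boxes is
constructed; the configuration-analytic hypotheses are met vacuously on `W = ∅`; no inhabitant at the datum of record is claimed (K0 OPEN); N22 NOT discharged (typed 28∕28 · discharged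
5∕27 UNCHANGED); one finite four-torus programme at fixed ε — NOT infinite volume, NOT OS on ℝ⁴, NOT a mass gap, NOT Clay.  0 `sorry`, 0 `def`, standard axioms.

References (TYPES only): [II] = [Balaban1988RG2Cluster] (1.11) p. 5, p. 13, (2.14)–(2.16) pp. 15–16 (degenerate data; bookkeeping); [I] = [Balaban1987RG1] (2.9)–(2.13) pp. 266–268.
-/

noncomputable section

namespace YMDAG.N22.W1

open Set Metric Matrix
open scoped BigOperators
open Literature.MathematicalPhysics.QuantumFieldTheory.Balaban1983to89
open Literature.MathematicalPhysics.QuantumFieldTheory.Balaban1983to89.TreeLengthTorus (TPt TDom tsys torusTreeLen torusTreeLen_nonneg)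
open Literature.MathematicalPhysics.QuantumFieldTheory.Balaban1983to89.B13Bound143 (invTau)
open Literature.MathematicalPhysics.QuantumFieldTheory.Balaban1983to89.B9SectDWalk (MajSumLe)
open Literature.MathematicalPhysics.QuantumFieldTheory.Balaban1983to89.B9Thm37GlueTorus (tdist1 tdist1_self tdist1_nonneg)
open Literature.MathematicalPhysics.QuantumFieldTheory.Balaban1983to89.B5TorusCover (UT)
open Literature.MathematicalPhysics.QuantumFieldTheory.Balaban1983to89.B12TreeDecay (kappa₀)
open Literature.MathematicalPhysics.QuantumFieldTheory.Balaban1983to89.Step (SFConsts)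
open Literature.MathematicalPhysics.QuantumFieldTheory.Balaban1983to89.B13JointWalkExpansion (JointWalkExpansion WalkMajorants)
open Literature.MathematicalPhysics.QuantumFieldTheory.Balaban1983to89.B13TermWalkData (WalkConsts TermKernels TermWalkData)
open Literature.MathematicalPhysics.QuantumFieldTheory.Balaban1983to89.B13TermWalkDataOneTorus (freeKernels)
open Literature.MathematicalPhysics.QuantumFieldTheory.Balaban1983to89.Node00.Sect2 (domSys domCount CPair spaceI domSites Setting Residual)
open Literature.MathematicalPhysics.QuantumFieldTheory.Balaban1983to89.Node00.W1

/-! ## §1 NODE A's free kernel record carries a walk record for EVERY package with `K̄_Γ ≥ 0`, `K̄_E, K̄_C ≥ 1` -/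

section FreeWalk

variable {d N' : ℕ} {ν : ℕ} {Nf : Fin ν → ℕ} [∀ i, NeZero (Nf i)] {E : Type*} [NormedAddCommGroup E] [NormedSpace ℂ E]

/-- One-term majorant families indexed by `Unit`: partial sums are at most the single (nonnegative) member, hence below any pointwise larger bound. [folklore] -/
private theorem majSumLe_unit {g : B6.Geometry} {K Kbar : g.Site → g.Site → ℝ} (hK : ∀ a b, 0 ≤ K a b) (hle : ∀ a b, K a b ≤ Kbar a b) :
    MajSumLe (fun (_ : Unit) a b => K a b) Kbar := by
  intro S a b
  calc ∑ _ω ∈ S, K a b ≤ ∑ _ω ∈ (Finset.univ : Finset Unit), K a b :=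
        Finset.sum_le_sum_of_subset_of_nonneg (Finset.subset_univ S) fun _ _ _ => hK a b
    _ = K a b := by simp
    _ ≤ Kbar a b := hle a b

/-- The identity matrix is torus-localised at ANY rate: `‖1(i,j)‖ ≤ e^{−ρ d₁(loc i, loc j)}` (the diagonal entry sits at distance `0`, the others vanish). [folklore] -/
private theorem one_apply_le_rate {Λ : Type} [Fintype Λ] [DecidableEq Λ] (locΛ : Λ → UT Nf) (ρ : ℝ) (i j : Λ) :
    ‖(1 : Matrix Λ Λ ℂ) i j‖ ≤ 1 * Real.exp (-(ρ * tdist1 Nf (locΛ i) (locΛ j))) := by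
  by_cases h : i = j
  · subst h; simp [tdist1_self]
  · rw [Matrix.one_apply_ne h, norm_zero]; positivity

/-- **NODE A's FREE KERNEL RECORD CARRIES A WALK RECORD FOR EVERY PACKAGE WITH `K̄_Γ ≥ 0`, `K̄_E, K̄_C ≥ 1`** (any `R, ε, κ, R_σ`): Γ-kernel `0` (one zero term), precision `1`
and covariance `1⁻¹ = 1` (one constant term each, amplitude `1`, walk distance the ℓ¹ torus distance, walk rate `κ + ε` ∕ `κ`), no σ-carrying terms, `X = ∅` — the identity's walk
«expansion» decays at any rate, so unlike `B13TermWalkDataOneTorus.termWalkData_free` (package `freeConsts`, drop `ε = 0`) the drop `ε` and the σ-distance `R_σ` are free here.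
Degenerate data; nothing about Bałaban's kernels. [cite: Balaban1988RG2Cluster, (1.11) p.5, p.13 and p.15 (degenerate data; bookkeeping)] -/
theorem termWalkData_freeKernels (c : B13.Consts) (Λ : Type) [Fintype Λ] [DecidableEq Λ] (C₀ : Type) (locΛ : Λ → UT Nf) (locN : Λ ⊕ C₀ → UT Nf)
    (w : WalkConsts) (hKΓ : 0 ≤ w.KbarΓ) (hKE : 1 ≤ w.KbarE) (hKC : 1 ≤ w.KbarC) :
    TermWalkData (freeKernels (d := d) (N' := N') c E Λ C₀ locΛ locN) w where
  hΓ := by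
    refine ⟨Unit, fun _ _ _ => 0, ∅, fun _ => 0, fun _ => tdist1 Nf, w.kap + w.ε, ?_⟩
    exact ⟨fun σ _ u _ i j => hasSum_unique (fun _ : Unit => (freeKernels (d := d) (N' := N') c E Λ C₀ locΛ locN).G2 σ u i j), fun _ σ _ i j => differentiableOn_const _,
      fun _ σ _ u _ i j => by simp [freeKernels],
      majSumLe_unit (fun a b => by simp) (fun a b => by rw [zero_mul]; exact mul_nonneg hKΓ (Real.exp_nonneg _)),
      fun _ _ σ _ => rfl, fun ω hω => by simp at hω, fun _ => le_rfl, fun _ a b => tdist1_nonneg a b⟩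
  hE := by
    refine ⟨Unit, fun _ _ _ => 1, ∅, fun _ => 1, fun _ => tdist1 Nf, w.kap + w.ε, ?_⟩
    exact ⟨fun σ _ u _ i j => hasSum_unique (fun _ : Unit => (freeKernels (d := d) (N' := N') c E Λ C₀ locΛ locN).A2 σ u i j), fun _ σ _ i j => differentiableOn_const _,
      fun _ σ _ u _ i j => one_apply_le_rate locΛ _ i j,
      majSumLe_unit (fun a b => by positivity) (fun a b => by
        rw [add_sub_cancel_right, one_mul]; exact le_mul_of_one_le_left (Real.exp_nonneg _) hKE),
      fun _ _ σ _ => rfl, fun ω hω => by simp at hω, fun _ => zero_le_one, fun _ a b => tdist1_nonneg a b⟩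
  hCov := by
    refine ⟨Unit, fun _ σ u => ((freeKernels (d := d) (N' := N') c E Λ C₀ locΛ locN).A2 σ u)⁻¹, fun _ => 1, fun _ => tdist1 Nf, w.kap, ?_⟩
    exact ⟨fun σ _ u _ i j => hasSum_unique (fun _ : Unit => ((freeKernels (d := d) (N' := N') c E Λ C₀ locΛ locN).A2 σ u)⁻¹ i j), fun _ σ _ u _ i j => by
        convert one_apply_le_rate (Nf := Nf) locΛ w.kap i j using 2 <;>
          first | rfl | (change ((1 : Matrix Λ Λ ℂ))⁻¹ i j = (1 : Matrix Λ Λ ℂ) i j; rw [inv_one]),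
      majSumLe_unit (fun a b => by positivity) (fun a b => by rw [one_mul]; exact le_mul_of_one_le_left (Real.exp_nonneg _) hKC), fun _ => zero_le_one⟩
  hfar := fun b z hz => by simp [freeKernels] at hz

end FreeWalk

/-! ## §2 A6: `nonempty_of_blocks_atPackage` fires at the free datum, the decaying free package, the zero reading, the zero action, empty boxes, the empty thickening -/

namespace SliceInputsL2U

/-- **★ A6 FOR MODULE J26: `nonempty_of_blocks_atPackage` FIRES AT DEGENERATE OBJECTS.**  For every constants record with `κ₁ ≥ 1` and W1-8's `0 < τ(d) ≤ ½`, every tables ∕ class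
letters with `E₀ ≥ 0`, every slice `Z` with `|Z| ≥ 1`, every set of domains `𝐃`, every base point `s₀ > 0`: the record `SliceInputsL2U 𝔇 χᵘ χᶜᵘ (realSliceWilson Wc) (realSliceOlder Oc) c Sg
Rz cs E₀ κ_E Z (𝐃, ∅) ∅ s₀ 0 1 (1∕100) Mv` is inhabited at SOME datum, boxes, potentials and vertex constant — and the proof is ONE APPLICATION OF J26 `nonempty_of_blocks_atPackage` with its
eighty-odd hypotheses discharged at: node00-def-W1's FREE datum W1-15 (opaque via an equation; one row bond, `ν = 0`, `m = 1`, `A ≡ 1`, `G ≡ 0`, `C = 1`, `X = ∅`, `r = 1`, `uOf = 0`), NODE A's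
free kernels at `c⁺` with the DECAYING package `(1, 1, 1, 0, 1, 1, 100)` (§1), `α = 1∕100`, rates `(½, ¼, ⅛, 1⁄16)`, `θ = 1⁄10`, the empty thickening `W = ∅` (the configuration-analytic
clauses vacuous), the zero complex reading (`C = μ = m = M𝒪 = 0`), the zero localized action (`𝔅c = univ`, `RA = 2`, `M𝒜 = M𝒲 = 0`, supports `∅`, `Cp = 0`, `κp = κ₀(4·2^d, 2d)`), print's
boxes on empty bond sets (`χ ≡ 1`, `ε₁ = 1`), window letters `γ₂ = κ = 1⁄100`, `T = e^{−(1∕s₀)²∕200}∕s₀²`, `Mv = 1 + T`, closures `a′ = w′ = w₀ = w_c = 0`, `a_c = 1⁄50`, `δ = 1⁄100` — the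
NUMERIC clauses (θ-dominations with `e^{−100} ≤ 1⁄100`, kernel smallness `θ < 1`, the sixteen mixed numerals at `cE = 1`, `g = 0`, `|Λ| = |Λ ⊕ C₀| = 1`, volume `≤ |Z|`) checked by
`norm_num` ∕ `linarith`.  INHABITATION IS NOT CONTENT. [cite: Balaban1988RG2Cluster, (2.14)-(2.16) pp.15-16 and (2.3) p.12 (degenerate data; bookkeeping); Balaban1987RG1, (2.9)-(2.13) pp.266-268] -/
theorem nonempty_of_blocks_atPackage_fires_free (c : B13.Consts) (hκ₁ : 1 ≤ c.κ₁) (hinv : ∀ d : ℝ, 0 ≤ d → 0 < invTau c d ∧ invTau c d ≤ 1 / 2)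
    (P : Params) (𝔸 : Type*) [NormedRing 𝔸] [NormedAlgebra ℂ 𝔸] [CompleteSpace 𝔸] (M k L : ℕ) [NeZero L]
    {G : Type*} [GaugeGroup G] (Sg : Setting 𝔸 G) (Rz : Residual P 𝔸) (cs : SFConsts) {E₀ : ℝ} (hE₀ : 0 ≤ E₀) (κE : ℝ)
    (Z : (domSys P M (k + 1)).Dom) (hZ : 1 ≤ (Z.1).card) (D : Finset (TDom P.d (L * domCount P M (k + 1)))) {s₀ : ℝ} (hs₀ : 0 < s₀) :
    ∃ (𝔇 : TermDatum214 c P 𝔸 M k L)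
      (χu χcu : (Z : (domSys P M (k + 1)).Dom) → (t : TermLabel P M k L) → ((𝔇.𝒦 Z t).Λ → ℝ) → ℝ)
      (Wc : 𝔇.ComplexWilson) (Oc : 𝔇.ComplexOlder) (Mv : ℝ),
      Nonempty (SliceInputsL2U 𝔇 χu χcu (𝔇.realSliceWilson Wc) (𝔇.realSliceOlder Oc) c Sg Rz cs E₀ κE Z ((D, ∅) : TermLabel P M k L) ∅ s₀ 0 1 (1 / 100) Mv) := by
  -- W1-15's free datum, kept OPAQUE (an equation) so that its baked instances are found syntactically (J12-W's device)
  obtain ⟨𝔇, h𝔇⟩ : ∃ 𝔇 : TermDatum214 c P 𝔸 M k L, 𝔇 = TermDatum214.free c P 𝔸 M k L := ⟨_, rfl⟩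
  set t : TermLabel P M k L := (D, ∅) with ht
  have ht2 : t.2 = ∅ := rfl
  -- the datum's reductions
  have hm : (𝔇.𝒦 Z t).m = 1 := by subst h𝔇; rfl
  have hpow : ∀ x : ℝ, x ^ 𝔇.ν = 1 := fun x => by subst h𝔇; exact pow_zero x
  have hr1 : 𝔇.r = 1 := by subst h𝔇; rfl
  have hcardΛ : Fintype.card (𝔇.𝒦 Z t).Λ = 1 := by subst h𝔇; exact Fintype.card_unit
  have hcardΛC : Fintype.card ((𝔇.𝒦 Z t).Λ ⊕ (𝔇.𝒦 Z t).C₀) = 1 := by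
    have h0 : Fintype.card (𝔇.𝒦 Z t).C₀ = 0 := Fintype.card_eq_zero_iff.2 ⟨fun x => by subst h𝔇; exact Empty.elim x⟩
    rw [Fintype.card_sum, hcardΛ, h0]
  -- NODE A's decaying free package and the walk record of the free kernels at `c⁺` (§1)
  have hw : (⟨1, 1, 1, 0, 1, 1, 100⟩ : WalkConsts).Admissible (1 / 100) 0 :=
    ⟨by norm_num, by norm_num, by norm_num, le_rfl, by norm_num, by norm_num, by norm_num⟩
  have h𝒦 : TermWalkData ({ (𝔇.𝒦 Z t) with } : TermKernels ({ c with κ₁ := c.κ₁ + 1 } : B13.Consts) P.d (domCount P M (k + 1)) 𝔇.ν 𝔇.Nf 𝔇.E₃)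
      (⟨1, 1, 1, 0, 1, 1, 100⟩ : WalkConsts) := by
    subst h𝔇
    exact termWalkData_freeKernels ({ c with κ₁ := c.κ₁ + 1 } : B13.Consts) Unit Empty _ _ _ le_rfl (by norm_num) (by norm_num)
  -- the fibre count of the site locations (one row bond, no extra column)
  have hfibN : ∀ x : UT 𝔇.Nf, (Finset.univ.filter fun j => (𝔇.𝒦 Z t).locN j = x).card ≤ (𝔇.𝒦 Z t).m := fun x =>
    (Finset.card_filter_le _ _).trans (by rw [Finset.card_univ, hcardΛC, hm])
  -- the one transcendental numeral: `e^{−εR_σ} = e^{−100} ≤ 1∕100`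
  have he : Real.exp (-100 : ℝ) ≤ 1 / 100 := by
    rw [Real.exp_neg]
    have h := Real.add_one_le_exp (100 : ℝ)
    rw [inv_le_comm₀ (Real.exp_pos _) (by norm_num)]
    linarith
  have he0 : 0 ≤ Real.exp (-100 : ℝ) := Real.exp_nonneg _
  -- W1-8's τ-letters positive
  have hτ : ∀ Y : TDom P.d (L * domCount P M (k + 1)), 0 < (invTau c ((tsys P.d (L * domCount P M (k + 1))).dj Y))⁻¹ := fun Y =>
    inv_pos.2 (hinv _ (torusTreeLen_nonneg Y.1)).1
  have hZ' : (1 : ℝ) ≤ ((Z.1).card : ℝ) := Nat.one_le_cast.2 hZ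
  have he2 : (2 : ℝ) ≤ Real.exp c.κ₁ := by
    have h := Real.add_one_le_exp (1 : ℝ)
    have h' : Real.exp 1 ≤ Real.exp c.κ₁ := Real.exp_le_exp.2 hκ₁
    linarith
  -- the window's tail letter at the base point
  set T : ℝ := Real.exp (-((1 / 100) / 2 * (1 / s₀) ^ 2)) / s₀ ^ 2 with hT
  have hs2 : 0 < s₀ ^ 2 := pow_pos hs₀ 2
  refine ⟨𝔇, fun _ _ _ => 1, fun _ _ _ => 1, 𝔇.readWilsonC fun _ _ => 0, 𝔇.readOlderC fun _ _ => TermDatum214.ReadingAtomsC.zero (S := Unit), 1 + T, ?_⟩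
  exact nonempty_of_blocks_atPackage 𝔇 (fun _ _ _ => 1) (fun _ _ _ => 1) Sg Rz cs E₀ κE Z t ∅ s₀ 0 1 (1 / 100) (1 + T)
    -- (T)
    isOpen_empty hinv (by rw [hr1]; exact one_pos) (by rw [hr1]; linarith)
    (fun Y => (invTau c ((tsys P.d (L * domCount P M (k + 1))).dj Y))⁻¹ + 𝔇.r + 2) (fun Y _ => le_rfl)
    -- (K)
    (w := ⟨1, 1, 1, 0, 1, 1, 100⟩) (α := 1 / 100) (Rσ₀ := 0) hw (by norm_num) h𝒦 (differentiableOn_empty) (mapsTo_empty _ _)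
    (fun ξ hξ => (Set.notMem_empty ξ hξ).elim) (fun ξ hξ => (Set.notMem_empty ξ hξ).elim)
    (κa := 1 / 2) (κb := 1 / 4) (kap' := 1 / 8) (kap'' := 1 / 16) (by norm_num) (by norm_num) (by norm_num) (by norm_num) (by norm_num)
    -- (O) + NODE A's numerics at θ := 1/10
    (θ := 1 / 10) hfibN (fun ξ hξ => (Set.notMem_empty ξ hξ).elim) (fun ξ hξ => (Set.notMem_empty ξ hξ).elim)
    (by norm_num; nlinarith [he, he0])
    (by norm_num)
    (by simp only [hm, hpow, Nat.cast_one]; norm_num)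
    (by simp only [hm, hpow, Nat.cast_one]; norm_num)
    (by norm_num) (by norm_num)
    -- (B) print's boxes on empty bond sets, threshold 1
    (fun _ _ => ∅) (fun _ _ => ∅) (ε₁ := 1) one_pos hs₀ (fun _ _ _ => by simp) (fun _ _ _ => by simp) (by rw [ht2]; rfl)
    (γ₂ := 1 / 100) (T := T) (TP := 0) (κ := 1 / 100) (r₁ := 0) (by norm_num) (by norm_num) (by positivity)
    (fun h => absurd ht2 h) (fun h => absurd ht2 h)
    (fun _ => by rw [hT, div_mul_cancel₀ _ hs2.ne'])
    (fun h => absurd ht2 h) (fun _ => le_rfl) (fun h => absurd ht2 h)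
    -- (N) the sixteen mixed numerals at cE = 1, g = 0, |Λ| = |Λ ⊕ C₀| = 1, a₅ = 1, |Z| ≥ 1
    (a' := 0) (w' := 0) (ac := 1 / 50) (wc := 0) (a₀ := 0) (w₀ := 0) (α₀ := 0)
    (by simp only [hm, hpow, Nat.cast_one]; norm_num)
    (by simp only [hm, hpow, Nat.cast_one]; norm_num)
    (by simp only [hm, hpow, hcardΛ, hcardΛC, Nat.cast_one]; norm_num; linarith)
    (by simp only [hm, hpow, Nat.cast_one]; norm_num)
    (by simp only [hm, hpow, Nat.cast_one]; norm_num)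
    (by simp only [hm, hpow, hcardΛ, hcardΛC, Nat.cast_one]; norm_num; linarith)
    le_rfl
    (by simp only [hm, hpow, Nat.cast_one]; norm_num)
    (by simp only [hm, hpow, Nat.cast_one]; norm_num)
    (by simp only [hm, hpow, hcardΛ, hcardΛC, Nat.cast_one]; norm_num; linarith)
    le_rfl
    (by simp only [hm, hpow, Nat.cast_one]; norm_num)
    (by simp only [hm, hpow, Nat.cast_one]; norm_num)
    (by simp only [hm, hpow, Nat.cast_one]; norm_num)
    (by simp only [hm, hpow, Nat.cast_one]; norm_num)
    (by simp only [hm, hpow, hcardΛ, hcardΛC, Nat.cast_one]; norm_num; linarith)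
    -- (W) the zero localized action, 𝔅c = univ, RA = 2, supports ∅, zero profile
    (𝔇.readWilsonC fun _ _ => 0) 0 (𝔅c := univ) (RA := 2) (by norm_num)
    (TermDatum214.wilsonOfActionOn_readWilsonC (fun _ _ => 0) Z t ∅ univ) isOpen_univ (subset_univ _) (fun _ => mem_univ _)
    (TermDatum214.LocActionC.zero_jointHoloOn ∅ univ) (M𝒜 := fun _ => 0) (TermDatum214.LocActionC.zero_supBoundOn ∅ 2) (fun _ _ => le_rfl)
    (TermDatum214.LocActionC.zero_realSliceMeasurable ∅) (fun _ => ∅) (TermDatum214.LocActionC.zero_localInC ∅ _) (fun _ => 0)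
    (fun _ => 0) (fun Y => by simp [TermDatum214.wilsonSupBound]) (Cp := 0) (κp := kappa₀ (4 * 2 ^ P.d) (2 * P.d))
    (fun _ _ b hb => (Finset.notMem_empty b hb).elim) le_rfl le_rfl (fun _ _ b hb => (Finset.notMem_empty b hb).elim)
    (fun Y _ => by simp)
    -- (L) the zero complex reading on the empty thickening
    (𝔇.readOlderC fun _ _ => TermDatum214.ReadingAtomsC.zero (S := Unit)) (Sa := Unit) (Ra := TermDatum214.ReadingAtomsC.zero) (C := 0) (mu := 0)
    (m := fun _ _ _ => 0)
    (TermDatum214.readsOnByC_readOlderC _ Z t _ ∅ univ)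
    (fun _ _ _ ξ hξ => (Set.notMem_empty ξ hξ).elim) (fun _ _ _ _ _ _ => differentiableOn_empty) (fun _ _ _ ξ hξ => (Set.notMem_empty ξ hξ).elim)
    (fun _ _ _ _ => continuous_const) le_rfl hE₀
    (fun _ _ _ => ⟨measurable_const, fun _ => le_of_eq norm_zero⟩)
    (fun _ _ _ => ⟨MeasureTheory.isFiniteMeasureZero, le_of_eq (MeasureTheory.measureReal_zero_apply _)⟩) (fun _ _ _ => le_rfl)
    (fun _ _ _ => ⟨MeasureTheory.isFiniteMeasureZero, le_of_eq (MeasureTheory.measureReal_zero_apply _)⟩)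
    (fun _ _ _ _ _ _ _ _ _ => rfl) (fun _ => 0) (fun Y => by simp [TermDatum214.crudeBound])
    -- (C) the closures at zero potentials
    (δ := 1 / 100) (by norm_num) (by norm_num) (by simp) (by norm_num) (by simp) (by simp)

end SliceInputsL2U

end YMDAG.N22.W1

end
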